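import Mathlib
import HarnessLib

/-!
# Item `LrcModEntire` (stmt-NavierStokesRegularity-20428) — T2b lever (LEAD ns-poloidal-K2-p3 g14, `Cruxes/LrcModEntire/T2B-g14.md` v1.2 §9 (Q2)/(Q3)):
# GENERIC QUASICONVEXITY TOOLKIT («ridge quasiconvexity ⇒ monotone / valley structure ⇒ convergence at the end»)

Cell ns-regularity-ideate, seat ns-k2-port-2 g4 (free hand, class-free, `--supports stmt-NavierStokesRegularity-20428 --as helper`; (Q0)/(Q1) themselves are the LEAD's bricks).
The memo's (Q2): «limits of quasiconvex functions are quasiconvex … a quasiconvex function on a complete branch has NO interior local maximum: it is monotone, or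
decreasing-then-increasing; on a branch periodic along itself it is CONSTANT», and (Q3): «bounded quasiconvex / monotone functions on [0,∞) converge at +∞» — here for
`f : ℝ → ℝ` and Mathlib's `QuasiconvexOn ℝ s f` (all sublevel sets convex):

* `le_max_of_mem_Icc` — three-point form `f y ≤ max (f x) (f z)` for `x ≤ y ≤ z` in `s`;
* `monotoneOn_of_lt` / `antitoneOn_of_lt` — after a strict increase `f x < f y` (`x < y`) the function is MONOTONE on `s ∩ [y, ∞)`; before a strict decrease it is ANTITONE;
* `antitoneOn_or_exists_monotoneOn` — the VALLEY dichotomy: antitone on all of `s`, or monotone on a final segment `s ∩ [y, ∞)`;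
* `exists_tendsto_atTop_of_abs_le` — a bounded quasiconvex function on `[a, ∞)` converges at `+∞`;
* (the companions «periodic quasiconvex ⇒ constant» and «pointwise limits stay quasiconvex» are in the LEAD's `…LrcModEntireRidgeQuasiconvex` (p704655) — not restated here).

WHAT THIS IS NOT: not a claim about Navier–Stokes regularity — elementary real analysis for a candidate line «ridge_hull» (T2B-g14 §9); `stub_T2b`, 20428/19708/27893 OPEN.
-/

noncomputable section

-- the summit and its single sub-problem share the name (CONVENTIONS §1), as in every Theorems file
set_option linter.dupNamespace false

namespace Summit.NavierStokesRegularity.NavierStokesRegularity.Theorems.PoloidalWindowDoorLrcModEntireTwistingTHRidgeQuasiconvexTools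

open Set Function Filter Topology

/-! ### Three-point form and the valley structure on the line -/

/-- **Three-point form**: `f y ≤ max (f x) (f z)` for `x ≤ y ≤ z` in `s`. -/
theorem le_max_of_mem_Icc {s : Set ℝ} {f : ℝ → ℝ} (hf : QuasiconvexOn ℝ s f) {x y z : ℝ} (hx : x ∈ s) (hz : z ∈ s) (hxy : x ≤ y) (hyz : y ≤ z) :
    f y ≤ max (f x) (f z) := by
  have hconv := hf (max (f x) (f z))
  have hseg := hconv.segment_subset (x := x) (y := z) ⟨hx, le_max_left _ _⟩ ⟨hz, le_max_right _ _⟩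
  rw [segment_eq_Icc (hxy.trans hyz)] at hseg
  exact (hseg ⟨hxy, hyz⟩).2

/-- **After a strict increase a quasiconvex function is monotone**: `x < y` in `s`, `f x < f y` ⇒ `f` is monotone on `s ∩ [y, ∞)`. -/
theorem monotoneOn_of_lt {s : Set ℝ} {f : ℝ → ℝ} (hf : QuasiconvexOn ℝ s f) {x y : ℝ} (hx : x ∈ s) (hxy : x < y) (hfxy : f x < f y) :
    MonotoneOn f (s ∩ Ici y) := by
  have h1 : ∀ z ∈ s, y ≤ z → f y ≤ f z := by
    intro z hz hyz
    have h := le_max_of_mem_Icc hf hx hz hxy.le hyz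
    rcases le_max_iff.1 h with h' | h'
    · exact absurd h' (not_le.2 hfxy)
    · exact h'
  intro z hz w hw hzw
  have h := le_max_of_mem_Icc hf hx hw.1 (hxy.le.trans hz.2) hzw
  rcases le_max_iff.1 h with h' | h'
  · exact absurd (h'.trans_lt hfxy) (not_lt.2 (h1 z hz.1 hz.2))
  · exact h'

/-- **Before a strict decrease a quasiconvex function is antitone**: `x < y` in `s`, `f y < f x` ⇒ `f` is antitone on `s ∩ (−∞, x]`. -/
theorem antitoneOn_of_lt {s : Set ℝ} {f : ℝ → ℝ} (hf : QuasiconvexOn ℝ s f) {x y : ℝ} (hy : y ∈ s) (hxy : x < y) (hfxy : f y < f x) :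
    AntitoneOn f (s ∩ Iic x) := by
  have h1 : ∀ w ∈ s, w ≤ x → f x ≤ f w := by
    intro w hw hwx
    have h := le_max_of_mem_Icc hf hw hy hwx hxy.le
    rcases le_max_iff.1 h with h' | h'
    · exact h'
    · exact absurd h' (not_le.2 hfxy)
  intro u hu w hw huw
  have h := le_max_of_mem_Icc hf hu.1 hy huw (hw.2.trans hxy.le)
  rcases le_max_iff.1 h with h' | h'
  · exact h'
  · exact absurd (h'.trans_lt hfxy) (not_lt.2 (h1 w hw.1 hw.2))

/-- **The valley dichotomy**: a quasiconvex function on `s ⊆ ℝ` is antitone on `s`, or monotone on a final segment `s ∩ [y, ∞)` (`y ∈ s`). -/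
theorem antitoneOn_or_exists_monotoneOn {s : Set ℝ} {f : ℝ → ℝ} (hf : QuasiconvexOn ℝ s f) :
    AntitoneOn f s ∨ ∃ y ∈ s, MonotoneOn f (s ∩ Ici y) := by
  by_cases h : ∃ x ∈ s, ∃ y ∈ s, x < y ∧ f x < f y
  · obtain ⟨x, hx, y, hy, hxy, hfxy⟩ := h
    exact Or.inr ⟨y, hy, monotoneOn_of_lt hf hx hxy hfxy⟩
  · push Not at h
    refine Or.inl fun x hx y hy hxy => ?_
    rcases eq_or_lt_of_le hxy with rfl | hlt
    · exact le_rfl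
    · exact h x hx y hy hlt

/-! ### Consequence: convergence at the end -/

/-- **A bounded quasiconvex function on `[a, ∞)` converges at `+∞`.** -/
theorem exists_tendsto_atTop_of_abs_le {f : ℝ → ℝ} {a M : ℝ} (hf : QuasiconvexOn ℝ (Ici a) f) (hM : ∀ x, a ≤ x → |f x| ≤ M) :
    ∃ l : ℝ, Tendsto f atTop (𝓝 l) := by
  rcases antitoneOn_or_exists_monotoneOn hf with h | ⟨y, hy, h⟩
  · -- antitone on `[a, ∞)`: converges to its infimum
    set g : ℝ → ℝ := fun x => f (max x a) with hg
    have hga : Antitone g := fun u w huw => h (mem_Ici.2 (le_max_right u a)) (mem_Ici.2 (le_max_right w a)) (max_le_max huw le_rfl)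
    have hbdd : BddBelow (range g) := ⟨-M, by rintro _ ⟨u, rfl⟩; exact (abs_le.1 (hM _ (le_max_right _ _))).1⟩
    refine ⟨⨅ x, g x, (tendsto_atTop_ciInf hga hbdd).congr' ?_⟩
    filter_upwards [Filter.eventually_ge_atTop a] with x hx
    simp [hg, max_eq_left hx]
  · -- monotone on `[max a y, ∞)`: converges to its supremum
    set b := max a y with hb
    set g : ℝ → ℝ := fun x => f (max x b) with hg
    have hmem : ∀ u, max u b ∈ Ici a ∩ Ici y := fun u => ⟨(le_max_left a y).trans (le_max_right _ _), (le_max_right a y).trans (le_max_right _ _)⟩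
    have hgm : Monotone g := fun u w huw => h (hmem u) (hmem w) (max_le_max huw le_rfl)
    have hbdd : BddAbove (range g) := ⟨M, by rintro _ ⟨u, rfl⟩; exact (abs_le.1 (hM _ (hmem u).1)).2⟩
    refine ⟨⨆ x, g x, (tendsto_atTop_ciSup hgm hbdd).congr' ?_⟩
    filter_upwards [Filter.eventually_ge_atTop b] with x hx
    simp [hg, max_eq_left hx]

end Summit.NavierStokesRegularity.NavierStokesRegularity.Theorems.PoloidalWindowDoorLrcModEntireTwistingTHRidgeQuasiconvexTools
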